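import Summits.CriticalPhenomena.CardyFormulaZ2.Theorems.CardyComplexConeEdgePrecompactUFRSStrandsHpArmsPureSectors
import Summits.CriticalPhenomena.CardyFormulaZ2.Theorems.CardyComplexConeEdgePrecompactUFRSStrandsHpArmsPureGeometry
import Literature.Probability.Percolation.KSTPeriodicCorridor

/-!
# Three strands of one completion ⇒ half-plane arms, IV: three genuine arms at mesh `1`
(line `qkz-strip-boundary-arm` of crux `CardyComplexCone.EdgePrecompact`, stmt-CriticalPhenomena-11387;
combinatorial core of the registered sub-goal `ufrs_rect_strandsHpArms_pure`, HT-A pure case)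

**Setting** (mesh `1`, all data abstract). A lattice box `V = [a₀, a₁] × [b₀, b₁]`, a family `In`
of faces lying in the box with their upper and right neighbours (the inner faces), two sets of
sites `A` ("wired arc") and `B` ("free arc") on the four sides of the box which together contain
every box site of the sides, and two configurations `β` (the completed one) and `ω` related as a
Dobrushin completion is to its sample: a `β`-open edge is `ω`-open or has both ends in `A`, and has
no end in `B`; the target edge of a corner with inner face, if `β`-closed, is `ω`-closed or touches
`B`; edges touching `B` are `β`-closed (`mem_bcBondConfig_cases`, `not_mem_bcBondConfig_cases`).
Near `z` (within `RT ≥ R`) the boundary is MONOCHROMATIC: no site of `A`, or no site of `B`.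

**Theorem** (`rect_threeArms`, registered anchor `ufrs_rectThreeArms`). Three corner-disjoint
orbit stretches of `nextCorner β` through inner faces across `A(z; r, R)` give THREE GENUINE ARMS
of `ω` across `A(z; r + 4, R - 4)`, not all of one colour: open arms through box sites along
`ω`-open edges, pairwise edge-disjoint; dual arms through inner faces crossing `ω`-closed edges,
pairwise crossing-disjoint. Proof: sectors relative to the exterior set `Z` of the shrunk box
(`strands_sectorsZ`, `ufrs_piecesMissExterior`; `Z` preconnected is a hypothesis, discharged by
`annulus_exterior_preconnected`). WIRED window (no `B` near): every right walk is genuine; the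
left walk of a strand whose left sector misses `Z` uses no `A`–`A` edge (its end on the side
would be a sector point in `Z`); take it and two right walks from distinct right sectors. FREE
window (no `A` near): every left walk is genuine; the right walk of a strand whose right sector
misses `Z` crosses no edge touching `B` (the crossed edge would leave a moat face whose outward
probe `moat_*_HTP` ends in `Z` inside the sector); take it and two left walks from distinct left
sectors.

References: S. Smirnov, C. R. Acad. Sci. Paris 333 (2001), §2; M. Aizenman, A. Burchard, Duke
Math. J. 99 (1999), Appendix A; G. F. Lawler, O. Schramm, W. Werner, Electron. J. Probab. 7
(2002), Appendix A.
-/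

namespace Summit.CriticalPhenomena.CardyFormulaZ2.Cruxes.EdgePrecompact.QkzStripBoundaryArm

open MeasureTheory Filter Set Metric Complex
open scoped Topology BigOperators Pointwise
open Literature.Probability.LatticeModels Literature.Probability.Percolation
open Literature.Probability.RandomPlanarGeometry (DobrushinDomain)
open Summit.CriticalPhenomena.CardyFormulaZ2.Theses.CardyComplexCone

noncomputable section

/-! ## Small tools: orienting a walk, packing three arms -/

/-- **Orienting a crossing walk** from its near end to its far end (reversal keeps supports,
edges, and the crossed edges of darts). -/
theorem orient_walk_HTP {x y : Site 2} (W : (zdGraph 2).Walk x y) (z : ℂ) (r R : ℝ)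
    (h : (dist (Site.toComplex x) z ≤ r + 4 ∧ R - 4 ≤ dist (Site.toComplex y) z) ∨
      (dist (Site.toComplex y) z ≤ r + 4 ∧ R - 4 ≤ dist (Site.toComplex x) z)) :
    ∃ (x' y' : Site 2) (W' : (zdGraph 2).Walk x' y'), dist (Site.toComplex x') z ≤ r + 4 ∧
      R - 4 ≤ dist (Site.toComplex y') z ∧ (∀ u ∈ W'.support, u ∈ W.support) ∧ (∀ e ∈ W'.edges, e ∈ W.edges) ∧
      (∀ d ∈ W'.darts, ∃ d₀ ∈ W.darts, sepEdge d.fst d.snd = sepEdge d₀.fst d₀.snd) := by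
  rcases h with ⟨h1, h2⟩ | ⟨h1, h2⟩
  · exact ⟨x, y, W, h1, h2, fun u hu => hu, fun e he => he, fun d hd => ⟨d, hd, rfl⟩⟩
  · refine ⟨y, x, W.reverse, h1, h2, fun u hu => ?_, fun e he => ?_, fun d hd => ?_⟩
    · rwa [SimpleGraph.Walk.support_reverse, List.mem_reverse] at hu
    · rwa [SimpleGraph.Walk.edges_reverse, List.mem_reverse] at he
    · rw [SimpleGraph.Walk.darts_reverse, List.mem_reverse, List.mem_map] at hd
      obtain ⟨d', hd', rfl⟩ := hd
      exact ⟨d', hd', by rw [SimpleGraph.Dart.symm_toProd, Prod.fst_swap, Prod.snd_swap, sepEdge_comm]⟩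

/-- **Packing three arms**, one of colour `κ₀` and two of the other colour, into the `Fin 3`-indexed
format "not all of one colour, pairwise condition for equal colours". -/
theorem pack3_HTP {γ : Type*} (P : Bool → γ → Prop) (Q : Bool → γ → γ → Prop) (κ₀ : Bool) (A₀ A₁ A₂ : γ)
    (h₀ : P κ₀ A₀) (h₁ : P (!κ₀) A₁) (h₂ : P (!κ₀) A₂) (h12 : Q (!κ₀) A₁ A₂) (h21 : Q (!κ₀) A₂ A₁) :
    ∃ (κ : Fin 3 → Bool) (arm : Fin 3 → γ),
      (∃ a b, κ a ≠ κ b) ∧ (∀ a, P (κ a) (arm a)) ∧ Pairwise (fun a b => κ a = κ b → Q (κ a) (arm a) (arm b)) := by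
  refine ⟨![κ₀, !κ₀, !κ₀], ![A₀, A₁, A₂], ⟨0, 1, by cases κ₀ <;> simp⟩, fun a => ?_, fun a b hab hκ => ?_⟩
  · fin_cases a
    · exact h₀
    · exact h₁
    · exact h₂
  · fin_cases a <;> fin_cases b
    · exact absurd rfl hab
    · simp at hκ
    · simp at hκ
    · simp at hκ
    · exact absurd rfl hab
    · simpa using h12
    · simp at hκ
    · simpa using h21
    · exact absurd rfl hab

/-! ## Three genuine arms -/

/-- **Three genuine arms from three strands of one completion** (mesh `1`; see the module
docstring for the dictionary `V, In, A, B, β, ω` and the proof). -/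
theorem rect_threeArms (V : Set (Site 2)) (a₀ a₁ b₀ b₁ : ℤ)
    (hV : ∀ v : Site 2, v ∈ V ↔ a₀ ≤ v 0 ∧ v 0 ≤ a₁ ∧ b₀ ≤ v 1 ∧ v 1 ≤ b₁)
    (In : Site 2 → Prop) (hIn : ∀ g, In g → a₀ ≤ g 0 ∧ g 0 + 1 ≤ a₁ ∧ b₀ ≤ g 1 ∧ g 1 + 1 ≤ b₁)
    (A B : Set (Site 2)) (hAB : ∀ x, x ∈ A ∨ x ∈ B → x ∈ V ∧ (x 0 = a₀ ∨ x 0 = a₁ ∨ x 1 = b₀ ∨ x 1 = b₁))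
    (β ω : BondConfig (Site 2))
    (hβo : ∀ e ∈ β, (e ∈ ω ∨ ∀ x ∈ e, x ∈ A) ∧ ∀ x ∈ e, x ∉ B)
    (hβc : ∀ p : Site 2 × Fin 4, In (cFace p) → cTgt p ∉ β → cTgt p ∉ ω ∨ ∃ x ∈ cTgt p, x ∈ B)
    (hβB : ∀ e : Sym2 (Site 2), (∃ x ∈ e, x ∈ B) → e ∉ β)
    (z : ℂ) {r R RT : ℝ} (hr : 0 ≤ r) (hrR : r + 16 ≤ R) (hRT : R ≤ RT)
    (hcol : (∀ x ∈ A, RT ≤ dist (Site.toComplex x) z) ∨ (∀ x ∈ B, RT ≤ dist (Site.toComplex x) z))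
    (hZc : IsPreconnected (exteriorSet z r R a₀ a₁ b₀ b₁))
    (c : Fin 3 → Site 2 × Fin 4) (i j : Fin 3 → ℕ) (hij : ∀ a, i a ≤ j a)
    (hdir : ∀ a, (dist (Site.toComplex (cornerOrbit β (c a) (i a)).1) z ≤ r ∧
        R ≤ dist (Site.toComplex (cornerOrbit β (c a) (j a)).1) z) ∨
      (R ≤ dist (Site.toComplex (cornerOrbit β (c a) (i a)).1) z ∧
        dist (Site.toComplex (cornerOrbit β (c a) (j a)).1) z ≤ r))
    (hinner : ∀ a t, i a ≤ t → t ≤ j a → In (cFace (cornerOrbit β (c a) t)))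
    (hdis : ∀ a b, a ≠ b → ∀ s t, i a ≤ s → s ≤ j a → i b ≤ t → t ≤ j b →
      cornerOrbit β (c a) s ≠ cornerOrbit β (c b) t) :
    ∃ (κ : Fin 3 → Bool) (x y : Fin 3 → Site 2) (W : ∀ a, (zdGraph 2).Walk (x a) (y a)),
      (∃ a b, κ a ≠ κ b) ∧
      (∀ a, dist (Site.toComplex (x a)) z ≤ r + 4 ∧ R - 4 ≤ dist (Site.toComplex (y a)) z ∧
        (κ a = true → (∀ u ∈ (W a).support, u ∈ V) ∧ ∀ e ∈ (W a).edges, e ∈ ω) ∧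
        (κ a = false → (∀ g ∈ (W a).support, In g) ∧ ∀ d ∈ (W a).darts, sepEdge d.fst d.snd ∉ ω)) ∧
      Pairwise (fun a b => κ a = κ b → (κ a = true → ∀ e ∈ (W a).edges, e ∉ (W b).edges) ∧
        (κ a = false → ∀ d ∈ (W a).darts, ∀ d' ∈ (W b).darts, sepEdge d.fst d.snd ≠ sepEdge d'.fst d'.snd)) := by
  classical
  set Z : Set ℂ := exteriorSet z r R a₀ a₁ b₀ b₁ with hZdef
  obtain ⟨cL, cR, xl, yl, xr, yr, WL, WR, hcL, hcR, hfibL, hfibR, hZL, hZR, hsecU, hWLs, hWLe, hWLends, hWRs, hWRd,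
      hWRends, hprobe⟩ :=
    strands_sectorsZ β z c i j hr hrR hij hdir hdis Z exteriorSet_annulus hZc
      (fun a t h1 h2 => ufrs_piecesMissExterior β (c a) (i a) (j a) z r R a₀ a₁ b₀ b₁
        (fun t' h1' h2' => hIn _ (hinner a t' h1' h2')) t h1 h2)
  /- vertices of corners with inner faces are box sites -/
  have hvertV : ∀ p : Site 2 × Fin 4, In (cFace p) → p.1 ∈ V := fun p hp => by
    have h1 := vertex_bounds_of_face_HTP p; have h2 := hIn _ hp; rw [hV]; omega
  /- shared edges force equal sectors -/
  have hshareL : ∀ s₁ s₂ e, e ∈ (WL s₁).edges → e ∈ (WL s₂).edges → cL s₁ = cL s₂ := by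
    intro s₁ s₂ e he₁ he₂
    obtain ⟨t, -, -, rfl, -⟩ := hWLe s₁ e he₁
    rw [cTgt_eq_mk] at he₁ he₂
    exact hcL s₁ s₂ _ (hWLs s₁ _ (SimpleGraph.Walk.fst_mem_support_of_mem_edges _ he₁)).1
      (hWLs s₂ _ (SimpleGraph.Walk.fst_mem_support_of_mem_edges _ he₂)).1
  have hshareR : ∀ s₁ s₂ (d d' : (zdGraph 2).Dart), d ∈ (WR s₁).darts → d' ∈ (WR s₂).darts →
      sepEdge d.fst d.snd = sepEdge d'.fst d'.snd → cR s₁ = cR s₂ := by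
    intro s₁ s₂ d d' hd hd' heq
    have he : s(d.fst, d.snd) = s(d'.fst, d'.snd) := by
      rw [← dualEdge_sepEdge d.adj, ← dualEdge_sepEdge d'.adj, heq]
    have h1 : d.fst ∈ (WR s₁).support := SimpleGraph.Walk.dart_fst_mem_support_of_mem_darts _ hd
    have h2 : d.fst ∈ (WR s₂).support := by
      rcases Sym2.eq_iff.1 he with ⟨h, -⟩ | ⟨h, -⟩
      · rw [h]; exact SimpleGraph.Walk.dart_fst_mem_support_of_mem_darts _ hd'
      · rw [h]; exact SimpleGraph.Walk.dart_snd_mem_support_of_mem_darts _ hd'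
    exact hcR s₁ s₂ _ (hWRs s₁ _ h1).1 (hWRs s₂ _ h2).1
  /- selection -/
  obtain ⟨⟨aL, haL⟩, bL₁, bL₂, hbL⟩ := select_three_HTP cL (fun s => (cL s ∩ Z).Nonempty) hfibL hZL
  obtain ⟨⟨aR, haR⟩, bR₁, bR₂, hbR⟩ := select_three_HTP cR (fun s => (cR s ∩ Z).Nonempty) hfibR hZR
  /- supports -/
  have hsuppL : ∀ s, ∀ u ∈ (WL s).support, u ∈ V := fun s u hu => by
    obtain ⟨-, t, h1, h2, rfl, -⟩ := hWLs s u hu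
    exact hvertV _ (hinner s t h1 h2)
  have hsuppR : ∀ s, ∀ g ∈ (WR s).support, In g := fun s g hg => by
    obtain ⟨-, t, h1, h2, rfl, -⟩ := hWRs s g hg
    exact hinner s t h1 h2
  /- the probe from a face of the right walk of `aR` cannot end in `Z` -/
  have hmoat : ∀ g ∈ (WR aR).support, ∀ p' : Site 2 × Fin 4, cFace p' = g → cTgt p' ∉ β → ∀ dv : ℂ, ‖dv‖ ≤ 1 →
      faceCenter (faceAt p'.1 (p'.2 + 1)) = faceCenter g + dv →
      faceCenter g + ((7 : ℝ) / 16) • dv ∉ Z := by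
    intro g hg p' hpg hp dv hdv hface hPZ
    obtain ⟨hgc, t, -, -, -, hd1, hd2⟩ := hWRs aR g hg
    obtain ⟨hPseg, hPnear⟩ := probe_mem_segment_HTP (faceCenter g) dv hdv
    have hPU : ∀ w ∈ segment ℝ (faceCenter g) (faceCenter g + ((7 : ℝ) / 16) • dv),
        r + 1 / 2 < dist w z ∧ dist w z < R - 1 / 2 := fun w hw => probe_annulus_HTP ⟨hd1, hd2⟩ (hPnear w hw)
    have hmem : faceCenter g + ((7 : ℝ) / 16) • dv ∈ cR aR :=
      hprobe aR g hg p' hpg hp _ (by rw [hface, hpg]; exact hPseg) hPU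
    exact haR ⟨_, hmem, hPZ⟩
  rcases hcol with hA | hB
  · /- FREE window: no site of `A` near `z` -/
    -- every left walk is genuine
    have hgenL : ∀ s, ∀ e ∈ (WL s).edges, e ∈ ω := by
      intro s e he
      obtain ⟨t, -, -, rfl, hopen, -, hd2⟩ := hWLe s e he
      rcases (hβo _ hopen).1 with h | h
      · exact h
      · have := hA _ (h _ (Sym2.mem_mk_left _ _)); linarith
    -- the right walk of `aR` is genuine
    have hgenR : ∀ d ∈ (WR aR).darts, sepEdge d.fst d.snd ∉ ω := by
      intro d hd hdω
      obtain ⟨t, h1, h2, hsep, hclosed, -, -⟩ := hWRd aR d hd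
      have hIn' : In (cFace (cornerOrbit β (c aR) t)) := hinner aR t h1 h2.le
      rcases hβc _ hIn' hclosed with h | ⟨x, hxe, hxB⟩
      · exact h (hsep ▸ hdω)
      -- the crossed edge touches `B` at `x`: `x` is on a side and is a corner of the face `d.fst`
      obtain ⟨hxV, hxside⟩ := hAB x (Or.inr hxB)
      set g : Site 2 := d.fst with hg
      have hgs : g ∈ (WR aR).support := SimpleGraph.Walk.dart_fst_mem_support_of_mem_darts _ hd
      have hgIn := hIn g (hsuppR aR g hgs)
      rw [← hsep] at hxe
      have hxg := KSTPeriodic.sepEdge_subset_face d.adj hxe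
      rw [← hg] at hxg
      have hx0 : x 0 = g 0 ∨ x 0 = g 0 + 1 := by omega
      have hx1 : x 1 = g 1 ∨ x 1 = g 1 + 1 := by omega
      have hgc := (hWRs aR g hgs).2
      obtain ⟨t', -, -, -, hd1, hd2⟩ := hgc
      have hcre : (faceCenter g).re = (g 0 : ℝ) + 1 / 2 := by simp [faceCenter]
      have hcim : (faceCenter g).im = (g 1 : ℝ) + 1 / 2 := by simp [faceCenter]
      have site_eq : ∀ {u v : Site 2}, u 0 = v 0 → u 1 = v 1 → u = v := fun h0 h1 => by
        ext k; fin_cases k; exacts [h0, h1]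
      rcases hxside with hs | hs | hs | hs
      · -- left side: `x 0 = a₀ = g 0`
        have hg0 : g 0 = a₀ := by omega
        obtain ⟨hf, ht, hc'⟩ := moat_left_HTP g
        have hxT : x ∈ cTgt (g, 0) := by
          rw [ht, Sym2.mem_iff]
          rcases hx1 with h | h
          · exact Or.inl (site_eq (by omega) h)
          · exact Or.inr (site_eq (by simp; omega) (by simp; omega))
        refine hmoat g hgs (g, 0) hf (hβB _ ⟨x, hxT, hxB⟩) (-1) (by simp) (by rw [hc', sub_eq_add_neg]) ?_
        obtain ⟨-, hPnear⟩ := probe_mem_segment_HTP (faceCenter g) (-1 : ℂ) (by simp)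
        refine ⟨probe_annulus_HTP ⟨hd1, hd2⟩ (hPnear _ (right_mem_segment _ _ _)), Or.inl ?_⟩
        have : (faceCenter g + ((7 : ℝ) / 16) • (-1 : ℂ)).re = (g 0 : ℝ) + 1 / 16 := by
          rw [add_re, hcre]; simp; ring
        rw [this, hg0]; linarith
      · -- right side: `x 0 = a₁ = g 0 + 1`
        have hg0 : g 0 + 1 = a₁ := by omega
        obtain ⟨hf, ht, hc'⟩ := moat_right_HTP g
        have hxT : x ∈ cTgt (g + Pi.single 0 1 + Pi.single 1 1, 2) := by
          rw [ht, Sym2.mem_iff]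
          rcases hx1 with h | h
          · exact Or.inr (site_eq (by simp; omega) (by simp; omega))
          · exact Or.inl (site_eq (by simp; omega) (by simp; omega))
        refine hmoat g hgs _ hf (hβB _ ⟨x, hxT, hxB⟩) 1 (by simp) (by rw [hc']) ?_
        obtain ⟨-, hPnear⟩ := probe_mem_segment_HTP (faceCenter g) (1 : ℂ) (by simp)
        refine ⟨probe_annulus_HTP ⟨hd1, hd2⟩ (hPnear _ (right_mem_segment _ _ _)), Or.inr (Or.inl ?_)⟩
        have : (faceCenter g + ((7 : ℝ) / 16) • (1 : ℂ)).re = (g 0 : ℝ) + 15 / 16 := by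
          rw [add_re, hcre]; simp; ring
        have e1 : (a₁ : ℝ) = g 0 + 1 := by exact_mod_cast hg0.symm
        rw [this, e1]; linarith
      · -- bottom side: `x 1 = b₀ = g 1`
        have hg1 : g 1 = b₀ := by omega
        obtain ⟨hf, ht, hc'⟩ := moat_bottom_HTP g
        have hxT : x ∈ cTgt (g + Pi.single 0 1, 1) := by
          rw [ht, Sym2.mem_iff]
          rcases hx0 with h | h
          · exact Or.inr (site_eq h (by omega))
          · exact Or.inl (site_eq (by simp; omega) (by simp; omega))
        refine hmoat g hgs _ hf (hβB _ ⟨x, hxT, hxB⟩) (-I) (by simp) (by rw [hc', sub_eq_add_neg]) ?_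
        obtain ⟨-, hPnear⟩ := probe_mem_segment_HTP (faceCenter g) (-I) (by simp)
        refine ⟨probe_annulus_HTP ⟨hd1, hd2⟩ (hPnear _ (right_mem_segment _ _ _)), Or.inr (Or.inr (Or.inl ?_))⟩
        have : (faceCenter g + ((7 : ℝ) / 16) • (-I)).im = (g 1 : ℝ) + 1 / 16 := by
          rw [add_im, hcim]; simp; ring
        rw [this, hg1]; linarith
      · -- top side: `x 1 = b₁ = g 1 + 1`
        have hg1 : g 1 + 1 = b₁ := by omega
        obtain ⟨hf, ht, hc'⟩ := moat_top_HTP g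
        have hxT : x ∈ cTgt (g + Pi.single 1 1, 3) := by
          rw [ht, Sym2.mem_iff]
          rcases hx0 with h | h
          · exact Or.inl (site_eq (by simp; omega) (by simp; omega))
          · exact Or.inr (site_eq (by simp; omega) (by simp; omega))
        refine hmoat g hgs _ hf (hβB _ ⟨x, hxT, hxB⟩) I (by simp) (by rw [hc']) ?_
        obtain ⟨-, hPnear⟩ := probe_mem_segment_HTP (faceCenter g) I (by simp)
        refine ⟨probe_annulus_HTP ⟨hd1, hd2⟩ (hPnear _ (right_mem_segment _ _ _)), Or.inr (Or.inr (Or.inr ?_))⟩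
        have : (faceCenter g + ((7 : ℝ) / 16) • I).im = (g 1 : ℝ) + 15 / 16 := by
          rw [add_im, hcim]; simp; ring
        have e1 : (b₁ : ℝ) = g 1 + 1 := by exact_mod_cast hg1.symm
        rw [this, e1]; linarith
    -- assemble: dual arm from `aR`, open arms from `bL₁`, `bL₂`
    obtain ⟨x₀, y₀, W₀, hx₀, hy₀, hs₀, -, hdd₀⟩ := orient_walk_HTP (WR aR) z r R (hWRends aR)
    obtain ⟨x₁, y₁, W₁, hx₁, hy₁, hs₁, he₁, -⟩ := orient_walk_HTP (WL bL₁) z r R (hWLends bL₁)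
    obtain ⟨x₂, y₂, W₂, hx₂, hy₂, hs₂, he₂, -⟩ := orient_walk_HTP (WL bL₂) z r R (hWLends bL₂)
    obtain ⟨κ, arm, hne, harm, hpw⟩ := pack3_HTP
      (fun κ (A : Σ x y : Site 2, (zdGraph 2).Walk x y) => dist (Site.toComplex A.1) z ≤ r + 4 ∧
        R - 4 ≤ dist (Site.toComplex A.2.1) z ∧
        (κ = true → (∀ u ∈ A.2.2.support, u ∈ V) ∧ ∀ e ∈ A.2.2.edges, e ∈ ω) ∧
        (κ = false → (∀ g ∈ A.2.2.support, In g) ∧ ∀ d ∈ A.2.2.darts, sepEdge d.fst d.snd ∉ ω))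
      (fun κ (A A' : Σ x y : Site 2, (zdGraph 2).Walk x y) => (κ = true → ∀ e ∈ A.2.2.edges, e ∉ A'.2.2.edges) ∧
        (κ = false → ∀ d ∈ A.2.2.darts, ∀ d' ∈ A'.2.2.darts, sepEdge d.fst d.snd ≠ sepEdge d'.fst d'.snd))
      false ⟨x₀, y₀, W₀⟩ ⟨x₁, y₁, W₁⟩ ⟨x₂, y₂, W₂⟩
      ⟨hx₀, hy₀, fun h => absurd h (by decide), fun _ => ⟨fun g hg => hsuppR aR g (hs₀ g hg), fun d hd => by
        obtain ⟨d₀, hd₀, he⟩ := hdd₀ d hd; rw [he]; exact hgenR d₀ hd₀⟩⟩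
      ⟨hx₁, hy₁, fun _ => ⟨fun u hu => hsuppL bL₁ u (hs₁ u hu), fun e he => hgenL bL₁ e (he₁ e he)⟩, fun h => absurd h (by decide)⟩
      ⟨hx₂, hy₂, fun _ => ⟨fun u hu => hsuppL bL₂ u (hs₂ u hu), fun e he => hgenL bL₂ e (he₂ e he)⟩, fun h => absurd h (by decide)⟩
      ⟨fun _ e hea heb => hbL (hshareL bL₁ bL₂ e (he₁ e hea) (he₂ e heb)), fun h => absurd h (by decide)⟩
      ⟨fun _ e hea heb => hbL (hshareL bL₁ bL₂ e (he₁ e heb) (he₂ e hea)), fun h => absurd h (by decide)⟩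
    exact ⟨κ, fun a => (arm a).1, fun a => (arm a).2.1, fun a => (arm a).2.2, hne, harm, hpw⟩
  · /- WIRED window: no site of `B` near `z` -/
    -- every right walk is genuine
    have hgenR : ∀ s, ∀ d ∈ (WR s).darts, sepEdge d.fst d.snd ∉ ω := by
      intro s d hd hdω
      obtain ⟨t, h1, h2, hsep, hclosed, -, hd2⟩ := hWRd s d hd
      rcases hβc _ (hinner s t h1 h2.le) hclosed with h | ⟨x, hxe, hxB⟩
      · exact h (hsep ▸ hdω)
      · have h3 := hB x hxB
        have h4 := dist_le_one_of_mem_cTgt hxe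
        linarith [dist_triangle (Site.toComplex x) (Site.toComplex (cornerOrbit β (c s) t).1) z]
    -- the left walk of `aL` is genuine
    have hgenL : ∀ e ∈ (WL aL).edges, e ∈ ω := by
      intro e he
      obtain ⟨t, -, -, rfl, hopen, hd1, hd2⟩ := hWLe aL e he
      rcases (hβo _ hopen).1 with h | h
      · exact h
      exfalso
      set v : Site 2 := (cornerOrbit β (c aL) t).1 with hv
      have hvA : v ∈ A := h v (Sym2.mem_mk_left _ _)
      have hvs : v ∈ (WL aL).support := SimpleGraph.Walk.fst_mem_support_of_mem_edges _ he
      obtain ⟨-, hvside⟩ := hAB v (Or.inl hvA)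
      refine haL ⟨Site.toComplex v, (hWLs aL v hvs).1, ⟨by linarith, by linarith⟩, ?_⟩
      simp only [Site.toComplex_re, Site.toComplex_im]
      rcases hvside with hs | hs | hs | hs
      · exact Or.inl (by rw [hs]; norm_num)
      · exact Or.inr (Or.inl (by rw [hs]; norm_num))
      · exact Or.inr (Or.inr (Or.inl (by rw [hs]; norm_num)))
      · exact Or.inr (Or.inr (Or.inr (by rw [hs]; norm_num)))
    -- assemble: open arm from `aL`, dual arms from `bR₁`, `bR₂`
    obtain ⟨x₀, y₀, W₀, hx₀, hy₀, hs₀, he₀, -⟩ := orient_walk_HTP (WL aL) z r R (hWLends aL)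
    obtain ⟨x₁, y₁, W₁, hx₁, hy₁, hs₁, -, hdd₁⟩ := orient_walk_HTP (WR bR₁) z r R (hWRends bR₁)
    obtain ⟨x₂, y₂, W₂, hx₂, hy₂, hs₂, -, hdd₂⟩ := orient_walk_HTP (WR bR₂) z r R (hWRends bR₂)
    obtain ⟨κ, arm, hne, harm, hpw⟩ := pack3_HTP
      (fun κ (A : Σ x y : Site 2, (zdGraph 2).Walk x y) => dist (Site.toComplex A.1) z ≤ r + 4 ∧
        R - 4 ≤ dist (Site.toComplex A.2.1) z ∧
        (κ = true → (∀ u ∈ A.2.2.support, u ∈ V) ∧ ∀ e ∈ A.2.2.edges, e ∈ ω) ∧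
        (κ = false → (∀ g ∈ A.2.2.support, In g) ∧ ∀ d ∈ A.2.2.darts, sepEdge d.fst d.snd ∉ ω))
      (fun κ (A A' : Σ x y : Site 2, (zdGraph 2).Walk x y) => (κ = true → ∀ e ∈ A.2.2.edges, e ∉ A'.2.2.edges) ∧
        (κ = false → ∀ d ∈ A.2.2.darts, ∀ d' ∈ A'.2.2.darts, sepEdge d.fst d.snd ≠ sepEdge d'.fst d'.snd))
      true ⟨x₀, y₀, W₀⟩ ⟨x₁, y₁, W₁⟩ ⟨x₂, y₂, W₂⟩
      ⟨hx₀, hy₀, fun _ => ⟨fun u hu => hsuppL aL u (hs₀ u hu), fun e he => hgenL e (he₀ e he)⟩, fun h => absurd h (by decide)⟩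
      ⟨hx₁, hy₁, fun h => absurd h (by decide), fun _ => ⟨fun g hg => hsuppR bR₁ g (hs₁ g hg), fun d hd => by
        obtain ⟨d₀, hd₀, he⟩ := hdd₁ d hd; rw [he]; exact hgenR bR₁ d₀ hd₀⟩⟩
      ⟨hx₂, hy₂, fun h => absurd h (by decide), fun _ => ⟨fun g hg => hsuppR bR₂ g (hs₂ g hg), fun d hd => by
        obtain ⟨d₀, hd₀, he⟩ := hdd₂ d hd; rw [he]; exact hgenR bR₂ d₀ hd₀⟩⟩
      ⟨fun h => absurd h (by decide), fun _ d hd d' hd' heq => by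
        obtain ⟨d₀, hd₀, he⟩ := hdd₁ d hd; obtain ⟨d₀', hd₀', he'⟩ := hdd₂ d' hd'
        exact hbR (hshareR bR₁ bR₂ d₀ d₀' hd₀ hd₀' (by rw [← he, ← he', heq]))⟩
      ⟨fun h => absurd h (by decide), fun _ d hd d' hd' heq => by
        obtain ⟨d₀, hd₀, he⟩ := hdd₂ d hd; obtain ⟨d₀', hd₀', he'⟩ := hdd₁ d' hd'
        exact hbR (hshareR bR₁ bR₂ d₀' d₀ hd₀' hd₀ (by rw [← he, ← he', heq]))⟩
    exact ⟨κ, fun a => (arm a).1, fun a => (arm a).2.1, fun a => (arm a).2.2, hne, harm, hpw⟩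


/-- **Three genuine arms from three strands of one completion** (registered anchor
`ufrs_rectThreeArms` of stmt-CriticalPhenomena-11387; `rect_threeArms` with all binders explicit). -/
theorem ufrs_rectThreeArms : ∀ (V : Set (Site 2)) (a₀ a₁ b₀ b₁ : ℤ), (∀ v : Site 2, v ∈ V ↔ a₀ ≤ v 0 ∧ v 0 ≤ a₁ ∧ b₀ ≤ v 1 ∧ v 1 ≤ b₁) → ∀ (In : Site 2 → Prop), (∀ g, In g → a₀ ≤ g 0 ∧ g 0 + 1 ≤ a₁ ∧ b₀ ≤ g 1 ∧ g 1 + 1 ≤ b₁) → ∀ (A B : Set (Site 2)), (∀ x, x ∈ A ∨ x ∈ B → x ∈ V ∧ (x 0 = a₀ ∨ x 0 = a₁ ∨ x 1 = b₀ ∨ x 1 = b₁)) → ∀ (β ω : BondConfig (Site 2)), (∀ e ∈ β, (e ∈ ω ∨ ∀ x ∈ e, x ∈ A) ∧ ∀ x ∈ e, x ∉ B) → (∀ p : Site 2 × Fin 4, In (cFace p) → cTgt p ∉ β → cTgt p ∉ ω ∨ ∃ x ∈ cTgt p, x ∈ B) → (∀ e : Sym2 (Site 2), (∃ x ∈ e,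 x ∈ B) → e ∉ β) → ∀ (z : ℂ) (r R RT : ℝ), 0 ≤ r → r + 16 ≤ R → R ≤ RT → ((∀ x ∈ A, RT ≤ dist (Site.toComplex x) z) ∨ (∀ x ∈ B, RT ≤ dist (Site.toComplex x) z)) → IsPreconnected (exteriorSet z r R a₀ a₁ b₀ b₁) → ∀ (c : Fin 3 → Site 2 × Fin 4) (i j : Fin 3 → ℕ), (∀ a, i a ≤ j a) → (∀ a, (dist (Site.toComplex (cornerOrbit β (c a) (i a)).1) z ≤ r ∧ R ≤ dist (Site.toComplex (cornerOrbit β (c a) (j a)).1) z) ∨ (R ≤ dist (Site.toComplex (cornerOrbit β (c a) (i a)).1) z ∧ dist (Site.toComplex (cornerOrbit β (c a) (j a)).1) z ≤ r)) → (∀ a t, i a ≤ t → t ≤ j a → In (cFace (cornerOrbit β (c a) t))) → (∀ a b, a ≠ b → ∀ s t, i a ≤ s → s ≤ j a → i b ≤ t → t ≤ j b → cornerOrbit β (c a) s ≠ cornerOrbit β (c b) t) → ∃ (κ : Fin 3 → Bool) (x y : Fin 3 → Site 2) (W : ∀ a, (zdGraph 2).Walk (x a) (y a)), (∃ a b, κ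 a ≠ κ b) ∧ (∀ a, dist (Site.toComplex (x a)) z ≤ r + 4 ∧ R - 4 ≤ dist (Site.toComplex (y a)) z ∧ (κ a = true → (∀ u ∈ (W a).support, u ∈ V) ∧ ∀ e ∈ (W a).edges, e ∈ ω) ∧ (κ a = false → (∀ g ∈ (W a).support, In g) ∧ ∀ d ∈ (W a).darts, sepEdge d.fst d.snd ∉ ω)) ∧ Pairwise (fun a b => κ a = κ b → (κ a = true → ∀ e ∈ (W a).edges, e ∉ (W b).edges) ∧ (κ a = false → ∀ d ∈ (W a).darts, ∀ d' ∈ (W b).darts, sepEdge d.fst d.snd ≠ sepEdge d'.fst d'.snd)) :=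
  fun V a₀ a₁ b₀ b₁ hV In hIn A B hAB β ω hβo hβc hβB z _r _R _RT hr hrR hRT hcol hZc c i j hij hdir hinner hdis =>
    rect_threeArms V a₀ a₁ b₀ b₁ hV In hIn A B hAB β ω hβo hβc hβB z hr hrR hRT hcol hZc c i j hij hdir hinner hdis

end

end Summit.CriticalPhenomena.CardyFormulaZ2.Cruxes.EdgePrecompact.QkzStripBoundaryArm
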